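import Summits.CriticalPhenomena.PercolationContinuityZ3.Theorems.Transplant.SkelFrmQuasiBParamsFaceFloorsTYA
import Summits.CriticalPhenomena.PercolationContinuityZ3.Theorems.Transplant.SkelFrmBParamsFaceFloorsTYA
import Summits.CriticalPhenomena.PercolationContinuityZ3.Theorems.Transplant.SkelFrmQuasiBParamsFaceCountsRangeA
import Summits.CriticalPhenomena.PercolationContinuityZ3.Theorems.Transplant.SkelFrmBParamsFaceCountsRangeA
import Summits.CriticalPhenomena.PercolationContinuityZ3.Theorems.Transplant.PlanarSkeletonFrmQuasiDefs
import Summits.CriticalPhenomena.PercolationContinuityZ3.Theorems.Transplant.PlanarSkeletonFrmDefs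
import Summits.CriticalPhenomena.PercolationContinuityZ3.Theorems.Transplant.SkelPhiStepIDataNS
import Summits.CriticalPhenomena.PercolationContinuityZ3.Theorems.Transplant.SkelFrmQuasi1ChoiceDefs
import Summits.CriticalPhenomena.PercolationContinuityZ3.Theorems.Transplant.SkelFrmQuasi1ParamsLBL
import Summits.CriticalPhenomena.PercolationContinuityZ3.Theorems.Transplant.SkelFrmQuasi1ParamsPO
import Summits.CriticalPhenomena.PercolationContinuityZ3.Theorems.Transplant.SkelFrmQuasiBChoiceNums
import Summits.CriticalPhenomena.PercolationContinuityZ3.Theorems.Transplant.SkelFrmQuasiBParamsFaceFloorsTXA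
import Summits.CriticalPhenomena.PercolationContinuityZ3.Theorems.Transplant.SkelFrmQuasiBParamsFaceRunA
import Summits.CriticalPhenomena.PercolationContinuityZ3.Theorems.Transplant.SkelFrmQuasiBParamsFaceUnits
import Summits.CriticalPhenomena.PercolationContinuityZ3.Theorems.Transplant.SkelFrmQuasiBParamsLF
import Summits.CriticalPhenomena.PercolationContinuityZ3.Theorems.Transplant.SkelFrmQuasiBParamsLFA
import HarnessLib
import Summits.CriticalPhenomena.PercolationContinuityZ3.Theorems.Transplant.SkelFrmBParamsFaceFloorsAYA
/-!
# GEN-Q PORT (WAVE-Q table v0.8 section 2, row G183, U-level L19; captain R-6/R-7 2026-08-27: carrier token swap `PlanarSkeletonFrmFrom ↦ PlanarSkeletonFrmQuasi`)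
# of the tree module «Transplant/SkelFrmFromBParamsFaceFloorsAYA» (sha256 740a760fdc5a11a5…) onto the quasi-step carrier `PlanarSkeletonFrmQuasi` (p507026): «SkelFrmQuasiBParamsFaceFloorsAYA»

HAND HUNK (L-FLOORMAP-1 ①⑥ / L-KitS-1 reader side; G017 «SkelFrmQuasiBChoiceNums», hp-8's KitSN): KS0.R'0→KS0.R'0N×44 — the kit of record at window cost `KS.NQ Φ`.

ORIGINAL TITLE: (F) VALUE LAYER, N2 twin (hp-8 g42, 2026-08-23; F-DISCHARGE-MAP-N2 G18 x-face tangential along floors FY1–FY4; (R-22)): `port_frm.py` text of N1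

builds on p205010 (kernel theorem, internal audit signed; external expert review pending) — nothing in this file uses p205010; NOTHING is claimed about any open node
((N3-b), the end state).  Lane `prim-bschramm`, seat `prim-bschramm-stmt` (gen 33; GEN-Q column pen; tool = captain gen-1 g4's port_genq.py R-14 --cone + p3-g30's T1 patch).  Helper file (`--supports stmt-CriticalPhenomena-4575 --as helper`).
PORT RULES (U-wave r1–r4 re-used, GEN-Q hunk classes of p3-g29 #6136): declaration order, names and proof texts are those of «SkelFrmFromBParamsFaceFloorsAYA», byte-identical except
(i) the carrier token `PlanarSkeletonFrmFrom ↦ PlanarSkeletonFrmQuasi` in binders, `namespace`/`end` lines and qualified names (module names `SkelFrmFrom… ↦ SkelFrmQuasi…`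
in imports of already-ported rows); (ii) `Φ.step ↦ Φ.qstep` with the called Steps lemma replaced by its `…Q`/`_q` twin and the cost `Φ.M` threaded (none in this file unless
listed below); (iii) `Φ.cyl_connected ↦ Φ.cyl_reach` readers (none unless listed); (iv) graph-ball radii / window floors ×`Φ.M` (none unless listed).  Carrier-free
residents stay imported/exported from the original «SkelFrmBParamsFaceFloorsAYA» exactly as in the FrmFrom port.  Docstrings and citations are the original's.

-/

noncomputable section

open scoped Classical

namespace Summit.CriticalPhenomena.PercolationContinuityZ3.Theorems.Transplant

namespace PlanarSkeletonFrmQuasi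

namespace NegB

open Literature.Probability.Percolation Literature.Probability.LatticeModels SimpleGraph
open SkelConc (Consts)
open Skelφ (shearUnit shearUnit_pos yBnd)
open Skelφ.StepI (DataN)
open TwoAxis.Para (modulus)
open Neg

namespace KS

section FloorsAY

/-- **The along extent of tangential region `k`**: `u·(yBnd k + 2n_L) ≤ 9·u·(n_L·m)` at `q := qB3XA (RA′)`, `R′ := RA′`, for `k + 1 ≤ 200·Kq + 10`. [folklore] -/
theorem yBnd_env (κ : Consts) {V : Type} [DecidableEq V] [Countable V] {G : SimpleGraph V} [G.LocallyFinite] (Φ : PlanarSkeletonFrmQuasi G) (t : V) (p : unitInterval) (D : Skelφ.StepI.DataNS V) (g : ℕ) (f : ℕ) (mk : ℕ) (hN : EqNumL κ Φ t p D g f) (hκ : (hL κ Φ t p D g f).natAbs ≤ 10 * nL κ Φ t p D g f)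
    (hnA24 : 2400 * Neg.Kq κ * (KS0.R'0N κ Φ (KS.NQ Φ) t p D mk + 2) ≤ nL κ Φ t p D g f) (hℓ : 22000 * Neg.Kq κ * (KS0.R'0N κ Φ (KS.NQ Φ) t p D mk + 2) ≤ ℓL κ Φ t p D g f)
    {k : ℕ} (hk : k + 1 ≤ 240 * Neg.Kq κ + 10) {u : ℤ} (hu : 0 ≤ u) :
    u * (yBnd (nL κ Φ t p D g f) (ℓL κ Φ t p D g f) (hL κ Φ t p D g f) (modulus (nL κ Φ t p D g f) (hL κ Φ t p D g f) (vL κ Φ t p D g f) (vβL κ Φ t p D g f))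
        (qB3XA κ Φ t p D g f (KS0.R'0N κ Φ (KS.NQ Φ) t p D mk)) (KS0.R'0N κ Φ (KS.NQ Φ) t p D mk) k + 2 * (nL κ Φ t p D g f : ℤ)) ≤
      9 * (u * ((nL κ Φ t p D g f : ℤ) * modulus (nL κ Φ t p D g f) (hL κ Φ t p D g f) (vL κ Φ t p D g f) (vβL κ Φ t p D g f))) := by
  have hnA : 2000 * Neg.Kq κ * (KS0.R'0N κ Φ (KS.NQ Φ) t p D mk + 2) ≤ nL κ Φ t p D g f :=
    le_trans (Nat.mul_le_mul_right _ (Nat.mul_le_mul_right _ (by norm_num))) hnA24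
  obtain ⟨hn1, hℓ1⟩ := one_le_of_eqNumL κ Φ t p D g f hN
  have hmm := Skelφ.NegPrm.modulus_vβOf hn1 (hL κ Φ t p D g f) (ℓL κ Φ t p D g f) (vL κ Φ t p D g f)
  have e : vβL κ Φ t p D g f = Skelφ.NegPrm.vβOf (nL κ Φ t p D g f) (hL κ Φ t p D g f) (ℓL κ Φ t p D g f) (vL κ Φ t p D g f) := rfl
  rw [← e] at hmm
  obtain ⟨hm1, hm2⟩ := hmm
  obtain ⟨hW, -⟩ := Wrun_spec κ Φ t p D g f hn1
  obtain ⟨-, -, -, sLa⟩ := sY_spec κ Φ t p D g f hn1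
  have hUe : (shearUnit (nL κ Φ t p D g f) (hL κ Φ t p D g f) : ℤ) = (nL κ Φ t p D g f : ℤ) + ((hL κ Φ t p D g f).natAbs : ℤ) := by
    unfold Skelφ.shearUnit; push_cast; ring
  have h10 : (((hL κ Φ t p D g f).natAbs : ℕ) : ℤ) ≤ 10 * (nL κ Φ t p D g f : ℤ) := by exact_mod_cast hκ
  have hh0 : (0 : ℤ) ≤ ((hL κ Φ t p D g f).natAbs : ℤ) := Nat.cast_nonneg _
  have hℓ' : 22000 * (Neg.Kq κ : ℤ) * ((KS0.R'0N κ Φ (KS.NQ Φ) t p D mk : ℤ) + 2) ≤ (ℓL κ Φ t p D g f : ℤ) := by exact_mod_cast hℓ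
  have hnA' : 2000 * (Neg.Kq κ : ℤ) * ((KS0.R'0N κ Φ (KS.NQ Φ) t p D mk : ℤ) + 2) ≤ (nL κ Φ t p D g f : ℤ) := by exact_mod_cast hnA
  have hk' : (k : ℤ) + 1 ≤ 240 * (Neg.Kq κ : ℤ) + 10 := by exact_mod_cast hk
  have hq3 : ((qB3XA κ Φ t p D g f (KS0.R'0N κ Φ (KS.NQ Φ) t p D mk) : ℕ) : ℤ) = (Wrun κ Φ t p D g f : ℤ) + 1000 * (Neg.Kq κ : ℤ) * (KS0.R'0N κ Φ (KS.NQ Φ) t p D mk : ℤ) + 2 := by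
    unfold qB3XA; push_cast; ring
  have hLa : yBnd (nL κ Φ t p D g f) (ℓL κ Φ t p D g f) (hL κ Φ t p D g f) (modulus (nL κ Φ t p D g f) (hL κ Φ t p D g f) (vL κ Φ t p D g f) (vβL κ Φ t p D g f))
        (qB3XA κ Φ t p D g f (KS0.R'0N κ Φ (KS.NQ Φ) t p D mk)) (KS0.R'0N κ Φ (KS.NQ Φ) t p D mk) k =
      modulus (nL κ Φ t p D g f) (hL κ Φ t p D g f) (vL κ Φ t p D g f) (vβL κ Φ t p D g f) * (3 * (nL κ Φ t p D g f : ℤ) + ((k : ℤ) + 1) * (KS0.R'0N κ Φ (KS.NQ Φ) t p D mk : ℕ)) +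
        (nL κ Φ t p D g f : ℤ) * (shearUnit (nL κ Φ t p D g f) (hL κ Φ t p D g f) : ℤ) *
          (2 * (k : ℤ) + (qB3XA κ Φ t p D g f (KS0.R'0N κ Φ (KS.NQ Φ) t p D mk) : ℕ) + ((k : ℤ) + 1) * (KS0.R'0N κ Φ (KS.NQ Φ) t p D mk : ℕ) + (LaY κ Φ t p D g f : ℤ) + 2) := by
    unfold Skelφ.yBnd LaY; push_cast; ring
  rw [hLa, hq3]
  clear hLa hq3 hℓ hnA hk hκ e
  have hn : (1 : ℤ) ≤ (nL κ Φ t p D g f : ℤ) := by exact_mod_cast hn1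
  have hKq : (1 : ℤ) ≤ (Neg.Kq κ : ℤ) := by exact_mod_cast Neg.one_le_Kq κ
  have hR0 : (0 : ℤ) ≤ (KS0.R'0N κ Φ (KS.NQ Φ) t p D mk : ℤ) := Nat.cast_nonneg _
  have hk0 : (0 : ℤ) ≤ (k : ℤ) := Nat.cast_nonneg _
  set U : ℤ := (shearUnit (nL κ Φ t p D g f) (hL κ Φ t p D g f) : ℤ)
  set n : ℤ := (nL κ Φ t p D g f : ℤ)
  set ℓ : ℤ := (ℓL κ Φ t p D g f : ℤ)
  set m := modulus (nL κ Φ t p D g f) (hL κ Φ t p D g f) (vL κ Φ t p D g f) (vβL κ Φ t p D g f)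
  set Q : ℤ := (Neg.Kq κ : ℤ)
  set R : ℤ := (KS0.R'0N κ Φ (KS.NQ Φ) t p D mk : ℤ)
  set W : ℤ := (Wrun κ Φ t p D g f : ℤ)
  set La : ℤ := (LaY κ Φ t p D g f : ℤ)
  have hU11 : U ≤ 11 * n := by rw [hUe]; linarith
  have hUn : n ≤ U := by rw [hUe]; linarith
  have hU0 : 0 ≤ U := by linarith
  have hm0 : 0 < m := by nlinarith
  have hQR : 0 ≤ Q * R := mul_nonneg (by linarith) hR0
  -- (a) `m·(k+1)·R ≤ m·210QR`, and `2000Q(R+2) ≤ n`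
  have a0 : ((k : ℤ) + 1) * R ≤ (240 * Q + 10) * R := mul_le_mul_of_nonneg_right hk' hR0
  have a1 : m * (((k : ℤ) + 1) * R) ≤ m * ((240 * Q + 10) * R) := mul_le_mul_of_nonneg_left a0 hm0.le
  have a1' : 9 * (m * ((240 * Q + 10) * R)) ≤ m * n := by
    have h9 : 9 * ((240 * Q + 10) * R) ≤ n := by nlinarith
    have := mul_le_mul_of_nonneg_left h9 hm0.le
    linarith
  -- (b) the `U·(…)` block: `U·(2k + W + 1000QR + 2 + (k+1)R + La + 2) ≤ 4m + n·X` with `n·X ≤ m`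
  have b1 : U * (1000 * Q * R) ≤ (11 * n) * (1000 * Q * R) := mul_le_mul_of_nonneg_right hU11 (mul_nonneg (by linarith) hR0)
  have b2 : U * (2 * (k : ℤ) + 4) ≤ (11 * n) * (2 * (240 * Q + 9) + 4) := mul_le_mul hU11 (by linarith) (by linarith) (by linarith)
  have b3 : U * (((k : ℤ) + 1) * R) ≤ (11 * n) * ((240 * Q + 10) * R) := mul_le_mul hU11 a0 (mul_nonneg (by linarith) hR0) (by linarith)
  have key : n * (11000 * Q * R + 11 * (2 * (240 * Q + 9) + 4) + 11 * ((240 * Q + 10) * R) + 26) ≤ n * (ℓ - 1) := by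
    refine mul_le_mul_of_nonneg_left ?_ (by linarith)
    nlinarith
  have hB : U * (2 * (k : ℤ) + (W + 1000 * Q * R + 2) + ((k : ℤ) + 1) * R + La + 2) ≤ 5 * m := by
    have e1 : U * (2 * (k : ℤ) + (W + 1000 * Q * R + 2) + ((k : ℤ) + 1) * R + La + 2) = U * (2 * (k : ℤ) + 4) + U * W + U * (1000 * Q * R) + U * (((k : ℤ) + 1) * R) + U * La := by ring
    rw [e1]; linarith
  have hB' : n * (U * (2 * (k : ℤ) + (W + 1000 * Q * R + 2) + ((k : ℤ) + 1) * R + La + 2)) ≤ n * (5 * m) := mul_le_mul_of_nonneg_left hB (by linarith)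
  have hn2 : 4 * (n * n) ≤ n * m := by
    have : n * (4 * n) ≤ n * m := mul_le_mul_of_nonneg_left (by nlinarith) (by linarith)
    linarith
  have htot : m * (3 * n + ((k : ℤ) + 1) * R) + n * U * (2 * (k : ℤ) + (W + 1000 * Q * R + 2) + ((k : ℤ) + 1) * R + La + 2) + 2 * n ≤ 9 * (n * m) := by
    have e2 : n * U * (2 * (k : ℤ) + (W + 1000 * Q * R + 2) + ((k : ℤ) + 1) * R + La + 2) = n * (U * (2 * (k : ℤ) + (W + 1000 * Q * R + 2) + ((k : ℤ) + 1) * R + La + 2)) := by ring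
    have e3 : m * (3 * n + ((k : ℤ) + 1) * R) = 3 * (n * m) + m * (((k : ℤ) + 1) * R) := by ring
    have hnn : n * 1 ≤ n * n := mul_le_mul_of_nonneg_left hn (by linarith)
    rw [e2, e3]; linarith
  have := mul_le_mul_of_nonneg_left htot hu
  linarith

/-- **`FY1` at the (ζ′) x-face tuple** (`σ = 1`): tangential region `k`'s lower along reading is above `flo`, given `hnear : 20r₀ − lev − 2u₀ ≤ FcA yT` and `u₀(j+1) ≤ r₀`.
[cite: KozmaNitzan2024, §4 Lemma 12 (pp. 23–25)] -/
theorem FY1_XA (κ : Consts) {V : Type} [DecidableEq V] [Countable V] {G : SimpleGraph V} [G.LocallyFinite] (Φ : PlanarSkeletonFrmQuasi G) (t : V) (p : unitInterval) (D : Skelφ.StepI.DataNS V) (g : ℕ) (f : ℕ) (P : PCells2T) (hP : P.toPCells2 = fcellsA κ Φ t p D g f) (mk : ℕ) (hN : EqNumL κ Φ t p D g f) (hκ : (hL κ Φ t p D g f).natAbs ≤ 10 * nL κ Φ t p D g f)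
    (hnA24 : 2400 * Neg.Kq κ * (KS0.R'0N κ Φ (KS.NQ Φ) t p D mk + 2) ≤ nL κ Φ t p D g f) (hℓ : 22000 * Neg.Kq κ * (KS0.R'0N κ Φ (KS.NQ Φ) t p D mk + 2) ≤ ℓL κ Φ t p D g f)
    (yT : Site 2) {lev : ℤ} {j k : ℕ} (hk : k + 1 ≤ 240 * Neg.Kq κ + 10) (hj : u₀A κ Φ t p D g f * ((j : ℤ) + 1) ≤ (P.r 0 : ℤ))
    (hnear : 20 * (P.r 0 : ℤ) - lev - 2 * u₀A κ Φ t p D g f ≤ FcA κ Φ t p D g f yT) :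
    (nL κ Φ t p D g f : ℤ) * modulus (nL κ Φ t p D g f) (hL κ Φ t p D g f) (vL κ Φ t p D g f) (vβL κ Φ t p D g f) *
        ((5 * (P.r 0 : ℤ) + 10 * u₀A κ Φ t p D g f * (j : ℤ) + 3 - lev) - FcA κ Φ t p D g f yT) ≤
      -(u₀A κ Φ t p D g f * (yBnd (nL κ Φ t p D g f) (ℓL κ Φ t p D g f) (hL κ Φ t p D g f) (modulus (nL κ Φ t p D g f) (hL κ Φ t p D g f) (vL κ Φ t p D g f) (vβL κ Φ t p D g f))
          (qB3XA κ Φ t p D g f (KS0.R'0N κ Φ (KS.NQ Φ) t p D mk)) (KS0.R'0N κ Φ (KS.NQ Φ) t p D mk) k + 2 * (nL κ Φ t p D g f : ℤ))) -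
        (nL κ Φ t p D g f : ℤ) * modulus (nL κ Φ t p D g f) (hL κ Φ t p D g f) (vL κ Φ t p D g f) (vβL κ Φ t p D g f) := by
  have hnA : 2000 * Neg.Kq κ * (KS0.R'0N κ Φ (KS.NQ Φ) t p D mk + 2) ≤ nL κ Φ t p D g f :=
    le_trans (Nat.mul_le_mul_right _ (Nat.mul_le_mul_right _ (by norm_num))) hnA24
  obtain ⟨hn1, hℓ1⟩ := one_le_of_eqNumL κ Φ t p D g f hN
  have hm0 : 0 < modulus (nL κ Φ t p D g f) (hL κ Φ t p D g f) (vL κ Φ t p D g f) (vβL κ Φ t p D g f) := Skelφ.NegPrm.modulus_vβOf_pos hn1 hℓ1 _ _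
  have hu : 1 ≤ u₀A κ Φ t p D g f := (units_eqA κ Φ t p D g f).2.2.2.2.1
  have hr0 : (P.r 0 : ℤ) = 40 * (Neg.Kq κ : ℤ) * u₀A κ Φ t p D g f := by rw [(cells_of_hP κ Φ t p D g f P hP).1 0]; exact (units_eqA κ Φ t p D g f).2.2.1
  have hKq : (1 : ℤ) ≤ (Neg.Kq κ : ℤ) := by exact_mod_cast Neg.one_le_Kq κ
  have hn : (1 : ℤ) ≤ (nL κ Φ t p D g f : ℤ) := by exact_mod_cast hn1
  have henv := yBnd_env κ Φ t p D g f mk hN hκ hnA24 hℓ hk (by linarith : 0 ≤ u₀A κ Φ t p D g f)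
  clear hnA hℓ hk hκ
  set n : ℤ := (nL κ Φ t p D g f : ℤ)
  set m := modulus (nL κ Φ t p D g f) (hL κ Φ t p D g f) (vL κ Φ t p D g f) (vβL κ Φ t p D g f)
  set u := u₀A κ Φ t p D g f
  set F := FcA κ Φ t p D g f yT
  set r : ℤ := (P.r 0 : ℤ)
  set B := yBnd (nL κ Φ t p D g f) (ℓL κ Φ t p D g f) (hL κ Φ t p D g f) m (qB3XA κ Φ t p D g f (KS0.R'0N κ Φ (KS.NQ Φ) t p D mk)) (KS0.R'0N κ Φ (KS.NQ Φ) t p D mk) k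
  have hnm : 0 < n * m := mul_pos (by linarith) hm0
  have hru : 40 * u ≤ r := by have : r = 40 * (Neg.Kq κ : ℤ) * u := hr0; nlinarith
  have p1 : n * m * ((5 * r + 10 * u * (j : ℤ) + 3 - lev) - F) ≤ n * m * (-(10 * u) - 2) := by
    refine mul_le_mul_of_nonneg_left ?_ hnm.le
    have : 10 * u * ((j : ℤ) + 1) ≤ 10 * r := by linarith
    linarith
  nlinarith

/-- **`FY2` at the (ζ′) x-face tuple** (`σ = 1`): tangential region `k`'s upper along reading is below `fhi`, given `hfarT : FcA yT ≤ 20r₀ − lev + 2u₀`.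
[cite: KozmaNitzan2024, §4 Lemma 12 (pp. 23–25)] -/
theorem FY2_XA (κ : Consts) {V : Type} [DecidableEq V] [Countable V] {G : SimpleGraph V} [G.LocallyFinite] (Φ : PlanarSkeletonFrmQuasi G) (t : V) (p : unitInterval) (D : Skelφ.StepI.DataNS V) (g : ℕ) (f : ℕ) (P : PCells2T) (hP : P.toPCells2 = fcellsA κ Φ t p D g f) (mk : ℕ) (hN : EqNumL κ Φ t p D g f) (hκ : (hL κ Φ t p D g f).natAbs ≤ 10 * nL κ Φ t p D g f)
    (hnA24 : 2400 * Neg.Kq κ * (KS0.R'0N κ Φ (KS.NQ Φ) t p D mk + 2) ≤ nL κ Φ t p D g f) (hℓ : 22000 * Neg.Kq κ * (KS0.R'0N κ Φ (KS.NQ Φ) t p D mk + 2) ≤ ℓL κ Φ t p D g f)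
    (yT : Site 2) {lev : ℤ} {k : ℕ} (hk : k + 1 ≤ 240 * Neg.Kq κ + 10)
    (hfarT : FcA κ Φ t p D g f yT ≤ 20 * (P.r 0 : ℤ) - lev + 2 * u₀A κ Φ t p D g f) :
    (nL κ Φ t p D g f : ℤ) * modulus (nL κ Φ t p D g f) (hL κ Φ t p D g f) (vL κ Φ t p D g f) (vβL κ Φ t p D g f) * (FcA κ Φ t p D g f yT + 1) +
        u₀A κ Φ t p D g f * (yBnd (nL κ Φ t p D g f) (ℓL κ Φ t p D g f) (hL κ Φ t p D g f) (modulus (nL κ Φ t p D g f) (hL κ Φ t p D g f) (vL κ Φ t p D g f) (vβL κ Φ t p D g f))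
          (qB3XA κ Φ t p D g f (KS0.R'0N κ Φ (KS.NQ Φ) t p D mk)) (KS0.R'0N κ Φ (KS.NQ Φ) t p D mk) k + (nL κ Φ t p D g f : ℤ)) ≤
      (nL κ Φ t p D g f : ℤ) * modulus (nL κ Φ t p D g f) (hL κ Φ t p D g f) (vL κ Φ t p D g f) (vβL κ Φ t p D g f) * (25 * (P.r 0 : ℤ) - 2 - lev) := by
  have hnA : 2000 * Neg.Kq κ * (KS0.R'0N κ Φ (KS.NQ Φ) t p D mk + 2) ≤ nL κ Φ t p D g f :=
    le_trans (Nat.mul_le_mul_right _ (Nat.mul_le_mul_right _ (by norm_num))) hnA24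
  obtain ⟨hn1, hℓ1⟩ := one_le_of_eqNumL κ Φ t p D g f hN
  have hm0 : 0 < modulus (nL κ Φ t p D g f) (hL κ Φ t p D g f) (vL κ Φ t p D g f) (vβL κ Φ t p D g f) := Skelφ.NegPrm.modulus_vβOf_pos hn1 hℓ1 _ _
  have hu : 1 ≤ u₀A κ Φ t p D g f := (units_eqA κ Φ t p D g f).2.2.2.2.1
  have hr0 : (P.r 0 : ℤ) = 40 * (Neg.Kq κ : ℤ) * u₀A κ Φ t p D g f := by rw [(cells_of_hP κ Φ t p D g f P hP).1 0]; exact (units_eqA κ Φ t p D g f).2.2.1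
  have hKq : (1 : ℤ) ≤ (Neg.Kq κ : ℤ) := by exact_mod_cast Neg.one_le_Kq κ
  have hn : (1 : ℤ) ≤ (nL κ Φ t p D g f : ℤ) := by exact_mod_cast hn1
  have henv := yBnd_env κ Φ t p D g f mk hN hκ hnA24 hℓ hk (by linarith : 0 ≤ u₀A κ Φ t p D g f)
  clear hnA hℓ hk hκ
  rw [hr0] at hfarT ⊢
  set n : ℤ := (nL κ Φ t p D g f : ℤ)
  set m := modulus (nL κ Φ t p D g f) (hL κ Φ t p D g f) (vL κ Φ t p D g f) (vβL κ Φ t p D g f)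
  set u := u₀A κ Φ t p D g f
  set F := FcA κ Φ t p D g f yT
  set Q : ℤ := (Neg.Kq κ : ℤ)
  set B := yBnd (nL κ Φ t p D g f) (ℓL κ Φ t p D g f) (hL κ Φ t p D g f) m (qB3XA κ Φ t p D g f (KS0.R'0N κ Φ (KS.NQ Φ) t p D mk)) (KS0.R'0N κ Φ (KS.NQ Φ) t p D mk) k
  have hnm : 0 < n * m := mul_pos (by linarith) hm0
  have hun : 0 ≤ u * n := mul_nonneg (by linarith) (by linarith)
  have p1 : n * m * (F + 1) ≤ n * m * (20 * (40 * Q * u) - lev + 2 * u + 1) := mul_le_mul_of_nonneg_left (by linarith) hnm.le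
  have p2 : n * m * (11 * u + 3) ≤ n * m * (5 * (40 * Q * u)) := mul_le_mul_of_nonneg_left (by nlinarith) hnm.le
  nlinarith

/-- **`FY3` at the (ζ′) x-face tuple** (`σ = −1`): mirror of `FY1` with `hnear : 20r₀ − lev − 2u₀ ≤ −FcA yT`. [cite: KozmaNitzan2024, §4 Lemma 12 (pp. 23–25)] -/
theorem FY3_XA (κ : Consts) {V : Type} [DecidableEq V] [Countable V] {G : SimpleGraph V} [G.LocallyFinite] (Φ : PlanarSkeletonFrmQuasi G) (t : V) (p : unitInterval) (D : Skelφ.StepI.DataNS V) (g : ℕ) (f : ℕ) (P : PCells2T) (hP : P.toPCells2 = fcellsA κ Φ t p D g f) (mk : ℕ) (hN : EqNumL κ Φ t p D g f) (hκ : (hL κ Φ t p D g f).natAbs ≤ 10 * nL κ Φ t p D g f)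
    (hnA24 : 2400 * Neg.Kq κ * (KS0.R'0N κ Φ (KS.NQ Φ) t p D mk + 2) ≤ nL κ Φ t p D g f) (hℓ : 22000 * Neg.Kq κ * (KS0.R'0N κ Φ (KS.NQ Φ) t p D mk + 2) ≤ ℓL κ Φ t p D g f)
    (yT : Site 2) {lev : ℤ} {j k : ℕ} (hk : k + 1 ≤ 240 * Neg.Kq κ + 10) (hj : u₀A κ Φ t p D g f * ((j : ℤ) + 1) ≤ (P.r 0 : ℤ))
    (hnear : 20 * (P.r 0 : ℤ) - lev - 2 * u₀A κ Φ t p D g f ≤ -FcA κ Φ t p D g f yT) :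
    (nL κ Φ t p D g f : ℤ) * modulus (nL κ Φ t p D g f) (hL κ Φ t p D g f) (vL κ Φ t p D g f) (vβL κ Φ t p D g f) *
        ((5 * (P.r 0 : ℤ) + 10 * u₀A κ Φ t p D g f * (j : ℤ) + 3 - lev) + FcA κ Φ t p D g f yT + 1) ≤
      -(u₀A κ Φ t p D g f * (yBnd (nL κ Φ t p D g f) (ℓL κ Φ t p D g f) (hL κ Φ t p D g f) (modulus (nL κ Φ t p D g f) (hL κ Φ t p D g f) (vL κ Φ t p D g f) (vβL κ Φ t p D g f))
          (qB3XA κ Φ t p D g f (KS0.R'0N κ Φ (KS.NQ Φ) t p D mk)) (KS0.R'0N κ Φ (KS.NQ Φ) t p D mk) k + (nL κ Φ t p D g f : ℤ))) := by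
  have hnA : 2000 * Neg.Kq κ * (KS0.R'0N κ Φ (KS.NQ Φ) t p D mk + 2) ≤ nL κ Φ t p D g f :=
    le_trans (Nat.mul_le_mul_right _ (Nat.mul_le_mul_right _ (by norm_num))) hnA24
  obtain ⟨hn1, hℓ1⟩ := one_le_of_eqNumL κ Φ t p D g f hN
  have hm0 : 0 < modulus (nL κ Φ t p D g f) (hL κ Φ t p D g f) (vL κ Φ t p D g f) (vβL κ Φ t p D g f) := Skelφ.NegPrm.modulus_vβOf_pos hn1 hℓ1 _ _
  have hu : 1 ≤ u₀A κ Φ t p D g f := (units_eqA κ Φ t p D g f).2.2.2.2.1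
  have hr0 : (P.r 0 : ℤ) = 40 * (Neg.Kq κ : ℤ) * u₀A κ Φ t p D g f := by rw [(cells_of_hP κ Φ t p D g f P hP).1 0]; exact (units_eqA κ Φ t p D g f).2.2.1
  have hKq : (1 : ℤ) ≤ (Neg.Kq κ : ℤ) := by exact_mod_cast Neg.one_le_Kq κ
  have hn : (1 : ℤ) ≤ (nL κ Φ t p D g f : ℤ) := by exact_mod_cast hn1
  have henv := yBnd_env κ Φ t p D g f mk hN hκ hnA24 hℓ hk (by linarith : 0 ≤ u₀A κ Φ t p D g f)
  clear hnA hℓ hk hκ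
  set n : ℤ := (nL κ Φ t p D g f : ℤ)
  set m := modulus (nL κ Φ t p D g f) (hL κ Φ t p D g f) (vL κ Φ t p D g f) (vβL κ Φ t p D g f)
  set u := u₀A κ Φ t p D g f
  set F := FcA κ Φ t p D g f yT
  set r : ℤ := (P.r 0 : ℤ)
  set B := yBnd (nL κ Φ t p D g f) (ℓL κ Φ t p D g f) (hL κ Φ t p D g f) m (qB3XA κ Φ t p D g f (KS0.R'0N κ Φ (KS.NQ Φ) t p D mk)) (KS0.R'0N κ Φ (KS.NQ Φ) t p D mk) k
  have hnm : 0 < n * m := mul_pos (by linarith) hm0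
  have hun : 0 ≤ u * n := mul_nonneg (by linarith) (by linarith)
  have hru : 40 * u ≤ r := by have : r = 40 * (Neg.Kq κ : ℤ) * u := hr0; nlinarith
  have p1 : n * m * ((5 * r + 10 * u * (j : ℤ) + 3 - lev) + F + 1) ≤ n * m * (-(10 * u) - 1) := by
    refine mul_le_mul_of_nonneg_left ?_ hnm.le
    have : 10 * u * ((j : ℤ) + 1) ≤ 10 * r := by linarith
    linarith
  nlinarith

/-- **`FY4` at the (ζ′) x-face tuple** (`σ = −1`): mirror of `FY2` with `hfarT : −FcA yT ≤ 20r₀ − lev + 2u₀`. [cite: KozmaNitzan2024, §4 Lemma 12 (pp. 23–25)] -/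
theorem FY4_XA (κ : Consts) {V : Type} [DecidableEq V] [Countable V] {G : SimpleGraph V} [G.LocallyFinite] (Φ : PlanarSkeletonFrmQuasi G) (t : V) (p : unitInterval) (D : Skelφ.StepI.DataNS V) (g : ℕ) (f : ℕ) (P : PCells2T) (hP : P.toPCells2 = fcellsA κ Φ t p D g f) (mk : ℕ) (hN : EqNumL κ Φ t p D g f) (hκ : (hL κ Φ t p D g f).natAbs ≤ 10 * nL κ Φ t p D g f)
    (hnA24 : 2400 * Neg.Kq κ * (KS0.R'0N κ Φ (KS.NQ Φ) t p D mk + 2) ≤ nL κ Φ t p D g f) (hℓ : 22000 * Neg.Kq κ * (KS0.R'0N κ Φ (KS.NQ Φ) t p D mk + 2) ≤ ℓL κ Φ t p D g f)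
    (yT : Site 2) {lev : ℤ} {k : ℕ} (hk : k + 1 ≤ 240 * Neg.Kq κ + 10)
    (hfarT : -FcA κ Φ t p D g f yT ≤ 20 * (P.r 0 : ℤ) - lev + 2 * u₀A κ Φ t p D g f) :
    -((nL κ Φ t p D g f : ℤ) * modulus (nL κ Φ t p D g f) (hL κ Φ t p D g f) (vL κ Φ t p D g f) (vβL κ Φ t p D g f) * FcA κ Φ t p D g f yT) +
        u₀A κ Φ t p D g f * (yBnd (nL κ Φ t p D g f) (ℓL κ Φ t p D g f) (hL κ Φ t p D g f) (modulus (nL κ Φ t p D g f) (hL κ Φ t p D g f) (vL κ Φ t p D g f) (vβL κ Φ t p D g f))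
          (qB3XA κ Φ t p D g f (KS0.R'0N κ Φ (KS.NQ Φ) t p D mk)) (KS0.R'0N κ Φ (KS.NQ Φ) t p D mk) k + 2 * (nL κ Φ t p D g f : ℤ)) +
        (nL κ Φ t p D g f : ℤ) * modulus (nL κ Φ t p D g f) (hL κ Φ t p D g f) (vL κ Φ t p D g f) (vβL κ Φ t p D g f) ≤
      (nL κ Φ t p D g f : ℤ) * modulus (nL κ Φ t p D g f) (hL κ Φ t p D g f) (vL κ Φ t p D g f) (vβL κ Φ t p D g f) * (25 * (P.r 0 : ℤ) - 2 - lev) := by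
  have hnA : 2000 * Neg.Kq κ * (KS0.R'0N κ Φ (KS.NQ Φ) t p D mk + 2) ≤ nL κ Φ t p D g f :=
    le_trans (Nat.mul_le_mul_right _ (Nat.mul_le_mul_right _ (by norm_num))) hnA24
  obtain ⟨hn1, hℓ1⟩ := one_le_of_eqNumL κ Φ t p D g f hN
  have hm0 : 0 < modulus (nL κ Φ t p D g f) (hL κ Φ t p D g f) (vL κ Φ t p D g f) (vβL κ Φ t p D g f) := Skelφ.NegPrm.modulus_vβOf_pos hn1 hℓ1 _ _
  have hu : 1 ≤ u₀A κ Φ t p D g f := (units_eqA κ Φ t p D g f).2.2.2.2.1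
  have hr0 : (P.r 0 : ℤ) = 40 * (Neg.Kq κ : ℤ) * u₀A κ Φ t p D g f := by rw [(cells_of_hP κ Φ t p D g f P hP).1 0]; exact (units_eqA κ Φ t p D g f).2.2.1
  have hKq : (1 : ℤ) ≤ (Neg.Kq κ : ℤ) := by exact_mod_cast Neg.one_le_Kq κ
  have hn : (1 : ℤ) ≤ (nL κ Φ t p D g f : ℤ) := by exact_mod_cast hn1
  have henv := yBnd_env κ Φ t p D g f mk hN hκ hnA24 hℓ hk (by linarith : 0 ≤ u₀A κ Φ t p D g f)
  clear hnA hℓ hk hκ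
  rw [hr0] at hfarT ⊢
  set n : ℤ := (nL κ Φ t p D g f : ℤ)
  set m := modulus (nL κ Φ t p D g f) (hL κ Φ t p D g f) (vL κ Φ t p D g f) (vβL κ Φ t p D g f)
  set u := u₀A κ Φ t p D g f
  set F := FcA κ Φ t p D g f yT
  set Q : ℤ := (Neg.Kq κ : ℤ)
  set B := yBnd (nL κ Φ t p D g f) (ℓL κ Φ t p D g f) (hL κ Φ t p D g f) m (qB3XA κ Φ t p D g f (KS0.R'0N κ Φ (KS.NQ Φ) t p D mk)) (KS0.R'0N κ Φ (KS.NQ Φ) t p D mk) k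
  have hnm : 0 < n * m := mul_pos (by linarith) hm0
  have p1 : n * m * (-F) ≤ n * m * (20 * (40 * Q * u) - lev + 2 * u) := mul_le_mul_of_nonneg_left (by linarith) hnm.le
  have p2 : n * m * (11 * u + 3) ≤ n * m * (5 * (40 * Q * u)) := mul_le_mul_of_nonneg_left (by nlinarith) hnm.le
  nlinarith

end FloorsAY

end KS

end NegB

end PlanarSkeletonFrmQuasi

end Summit.CriticalPhenomena.PercolationContinuityZ3.Theorems.Transplant

end
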